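import Summits.HodgeConjecture.HodgeConjecture.Theorems.Ring2AbelianAllWeilSymmetrisedRungs
import Summits.HodgeConjecture.HodgeConjecture.Theorems.Ring2HypothesesLandherrRebase
import HarnessLib

/-!
# Ring 2 · AbelianAll (ab-weil-1, gen 138) — the non-split slice RE-TYPED POINTED:
  `HyperplanePullbackAlongIsogeny` erased from the non-split side of the Weil-field re-indexing

research route, not a corollary; conditional on HC_CM plus one named minimal statement.
Cell line: research route conditional on HC_CM; not a corollary; Q11.4-sentence-2 already refuted in dim ≥ 3.
`HC_CM` (`Theses.RankFourFaces.CMAbelianHodge`) does not occur in this file. No case of the Hodge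
conjecture is claimed: every statement below is an IMPLICATION or EQUIVALENCE between open statements
(plus the on-path sanity implication from `HodgeConjecture`).

Gen 137 (`Ring2AbelianAllWeilSymmetrisedRungs`) erased the print obligation `H_amp =
HyperplanePullbackAlongIsogeny` from the split slices, the named split rungs and ALL the δ-cells, but NOT from
gen 5's non-split slice `WeilAlgebraicNonsplitHyperplane n d`, whose hypothesis "NO `K`-symmetrised hyperplane
class of `(A, φ)` is hyperbolic" quantifies over every projective embedding of the variety: transporting it
DOWN an isogeny `p : A → B` needs a hyperplane class of `A` over every hyperplane class of `B` — which is
`H_amp`. The present file re-types the non-split slice POINTED (§1): `WeilAlgebraicNonsplitHyperplaneAt n d` —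
for every `(A, φ, e, a)` (`dim A = 2n`, `φ² = -d`, `a ≠ 0` a rational class on the ambient `ℙᴺ` of the
embedding `e`) whose symmetrised hyperplane class `d·e^*a + φ^*e^*a` is NOT hyperbolic, the rational Hodge
Weil classes of `(A, φ, d)` are algebraic. This is the literal δ-free form of "all the NON-split cells
`(n, d, δ)`, `δ ≠ [(-1)ⁿ]`" (§3, both directions, FACT-FREE: van Geemen's Lemma 5.2 existence/uniqueness of
`det H` and Landherr's criterion are theorems of the tree), it is STRONGER than gen 5's slice (§2: a fixed
`(A, φ)` may carry polarizations of several discriminants), and — the point — its square-class transport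
`d ⟹ m²d` is FREE of `H_amp` (§4, by gen 137's `exists_symmetrisedDescent`: only the symmetrised class of the
descended variety matters, and non-hyperbolicity is invariant along `K`-equivariant isogenies and under
non-zero scalars). Consequences (§5): the pointed non-split slices are indexed by the Weil FIELD
`K = ℚ(√-d)` unconditionally, and R1′ `NonsplitSixfolds` follows from the pointed slices at SQUAREFREE `d`
alone, with no print obligation (gen 5's `nonsplitSixfolds_iff_squarefree H` needed `H_amp` for this
direction). §6 records what is still not erased: the converse comparison un-pointed ⟹ pointed at a fixed
`d` (it would need Markman's split statement or `H_amp`), hence the `↔` of gen 5 in the un-pointed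
formulation.

## References
* B. van Geemen, LNM 1594 (1994), Lemma 5.2 (1)–(3), 4.14, 5.4, (5.4.1). [vanGeemen1994HodgeAV]
* W. Landherr, Abh. Math. Sem. Hamburg 11 (1936). [Landherr1936HermitianForms]
* D. Mumford, *Abelian Varieties* (1970), §19 Thm. 3 and p. 173. [MumfordAV1970]
* B. Moonen, Yu. Zarhin, Crelle 496 (1998), §1. [MoonenZarhin1998WeilClasses]
* E. Markman, arXiv:2509.23403, §1.1, §11.5 Step 1, §12. [Markman2025SurveySecant]
* P. Deligne (notes by J. Milne), LNM 900 (1982), §4 Cor. 4.2, Thm. 4.8. [Deligne1982HodgeCycles]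
-/

noncomputable section

set_option linter.dupNamespace false

open CategoryTheory AlgebraicGeometry
open Literature.AlgebraicGeometry Literature.AlgebraicGeometry.Motives
open Literature.AlgebraicGeometry.HodgeTheory
open Literature.AlgebraicGeometry.VanGeemen1994
open Literature.AlgebraicTopology.SingularHomology
open Summit.HodgeConjecture.HodgeConjecture.Cruxes.HodgeAbelianVarieties.EStepSecantInduction
open Summit.HodgeConjecture.HodgeConjecture.WeilTypeLadder
open Summit.HodgeConjecture.HodgeConjecture.Ring2.Hypotheses

namespace Summit.HodgeConjecture.HodgeConjecture.Ring2.AbelianAll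

/-! ### §1 The pointed non-split slice -/

/-- **The NON-SPLIT slice at `(n, d)`, POINTED by the polarization.** For every abelian variety `A` of
dimension `2n` with `φ ≫ φ = -d`, every projective embedding `e` of `A` and every non-zero rational class `a`
on the ambient projective space such that the `K`-symmetrised hyperplane class `d·e^*a + φ^*e^*a` is NOT
hyperbolic (`¬ IsHyperbolicWeilType`; by van Geemen (5.4.1) / Landherr: `det H ≠ [(-1)ⁿ]`, §3), the rational
Hodge Weil classes of `(A, φ, d)` are algebraic (`WeilAlgebraicFor`). The binders are those of typer's split
slice `Stubs.WeilAlgebraicSplitHyperplane` with the hyperbolicity hypothesis negated. OPEN: a case of the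
Hodge conjecture for abelian varieties, not claimed. [cite: vanGeemen1994HodgeAV, Lemma 5.2 (3) and (5.4.1)]
[cite: Markman2025SurveySecant, §11.5 Step 1] -/
def WeilAlgebraicNonsplitHyperplaneAt (n d : ℕ) : Prop :=
  ∀ (A : AbelianVariety ℂ) (φ : A ⟶ A) (e : ProjectiveEmbedding A.X)
    (a : complexBetti (projectiveSpace e.n ℂ) 2), A.dim = 2 * n → φ ≫ φ = -(d • 𝟙 A) →
      IsRationalClass a → a ≠ 0 →
        ¬ IsHyperbolicWeilType A φ n
          ((d : ℂ) • complexBetti.map e.ι 2 a + complexBetti.map φ.hom.hom.hom 2 (complexBetti.map e.ι 2 a)) →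
          WeilAlgebraicFor n d A φ

/-- ON-PATH: `HodgeConjecture →` the pointed non-split slice, every `(n, d)`. -/
theorem weilAlgebraicNonsplitHyperplaneAt_of_hodgeConjecture (h : _root_.HodgeConjecture) (n d : ℕ) :
    WeilAlgebraicNonsplitHyperplaneAt n d :=
  fun _ _ _ _ hA _ _ _ _ c _ hc hnn => (h (isSmoothProjective_of_dim_eq' hA)).2 n c hc hnn

/-! ### §2 Pointed versus un-pointed -/

/-- **Pointed ⟹ un-pointed** (`n, d ≥ 1`): the pointed non-split slice implies gen 5's slice
`WeilAlgebraicNonsplitHyperplane n d` ("no symmetrised hyperplane class of `(A, φ)` is hyperbolic ⟹ …"), since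
every abelian `2n`-fold, `n ≥ 1`, HAS a projective embedding with a non-zero rational ambient class
(`exists_projectiveEmbedding_hasWeilDiscriminantNondeg`, van Geemen 5.2 (1)).
[cite: vanGeemen1994HodgeAV, Lemma 5.2 (1)–(3)] -/
theorem weilAlgebraicNonsplitHyperplane_of_at {n d : ℕ} (hn : 0 < n) (hd : 0 < d)
    (h : WeilAlgebraicNonsplitHyperplaneAt n d) : WeilAlgebraicNonsplitHyperplane n d := by
  intro A φ hA hφ hnon
  obtain ⟨e, a, -, ha, ha0, -⟩ := exists_projectiveEmbedding_hasWeilDiscriminantNondeg hn hA hd hφ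
  exact h A φ e a hA hφ ha ha0 (hnon e a ha ha0)

/-- **Un-pointed non-split slice ∧ split slice ⟹ pointed non-split slice** (every `n, d`): if `(A, φ)` has
some hyperbolic symmetrised hyperplane class the split slice applies, else gen 5's non-split slice does.
[cite: vanGeemen1994HodgeAV, 5.4 and (5.4.1)] [cite: Markman2025SurveySecant, §11.5 Step 1] -/
theorem weilAlgebraicNonsplitHyperplaneAt_of_nonsplit_of_split {n d : ℕ}
    (hN : WeilAlgebraicNonsplitHyperplane n d) (hS : Stubs.WeilAlgebraicSplitHyperplane n d) :
    WeilAlgebraicNonsplitHyperplaneAt n d := by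
  intro A φ e a hA hφ ha ha0 _
  by_cases hex : ∃ (e' : ProjectiveEmbedding A.X) (a' : complexBetti (projectiveSpace e'.n ℂ) 2),
      IsRationalClass a' ∧ a' ≠ 0 ∧
        IsHyperbolicWeilType A φ n
          ((d : ℂ) • complexBetti.map e'.ι 2 a' + complexBetti.map φ.hom.hom.hom 2 (complexBetti.map e'.ι 2 a'))
  · obtain ⟨e', a', ha', ha'0, hhyp⟩ := hex
    exact hS A φ e' a' hA hφ ha' ha'0 hhyp
  · push Not at hex
    exact hN A φ hA hφ fun e' a' ha' ha'0 => hex e' a' ha' ha'0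

/-- **The whole `(n, d)`-slice IS the pointed non-split slice ∧ the split slice** (`n, d ≥ 1`): every rational
Hodge Weil class of EVERY `(A, φ)` of type `(n, d)` is algebraic (`WeilAlgebraicAll n d`) iff both pointed
slices hold — every `(A, φ)` carries SOME symmetrised hyperplane class, hyperbolic or not.
[cite: vanGeemen1994HodgeAV, Lemma 5.2 (1)–(3) and (5.4.1)] -/
theorem weilAlgebraicAll_iff_at_and_split {n d : ℕ} (hn : 0 < n) (hd : 0 < d) :
    WeilAlgebraicAll n d ↔ WeilAlgebraicNonsplitHyperplaneAt n d ∧ Stubs.WeilAlgebraicSplitHyperplane n d := by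
  refine ⟨fun h => ⟨fun A φ _ _ hA hφ _ _ _ => h A φ hA hφ, fun A φ _ _ hA hφ _ _ _ => h A φ hA hφ⟩,
    fun ⟨hN, hS⟩ A φ hA hφ => ?_⟩
  obtain ⟨e, a, -, ha, ha0, -⟩ := exists_projectiveEmbedding_hasWeilDiscriminantNondeg hn hA hd hφ
  by_cases hhyp : IsHyperbolicWeilType A φ n
      ((d : ℂ) • complexBetti.map e.ι 2 a + complexBetti.map φ.hom.hom.hom 2 (complexBetti.map e.ι 2 a))
  · exact hS A φ e a hA hφ ha ha0 hhyp
  · exact hN A φ e a hA hφ ha ha0 hhyp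

/-! ### §3 The pointed non-split slice IS the conjunction of the non-split δ-cells — fact-free -/

/-- **Pointed non-split slice ⟹ every NON-split cell `(n, d, δ)`, `δ ≠ [(-1)ⁿ]`** (`n, d ≥ 1`). A symmetrised
hyperplane class with a non-degenerate discriminant witness of class `δ ≠ [(-1)ⁿ]` is not hyperbolic: a
hyperbolic one has a witness of class `[(-1)ⁿ]` (`hasWeilDiscriminantNondeg_neg_one_pow_of_isHyperbolicWeilType`,
van Geemen (5.4.1) forward) and `det H` is unique (`existsUnique_hasWeilDiscriminantNondeg`, 5.2 (3)).
No Landherr needed in this direction. [cite: vanGeemen1994HodgeAV, Lemma 5.2 (3) and (5.4.1)]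
[cite: Deligne1982HodgeCycles, §4 Cor. 4.2] -/
theorem weilClassesComponent_of_at {n d : ℕ} (hn : 0 < n) (hd : 0 < d)
    (h : WeilAlgebraicNonsplitHyperplaneAt n d) {δ : weilNormResidueGroup d}
    (hδ : δ ≠ splitDiscriminantClass n d) : WeilClassesComponent n d δ := by
  intro A φ hA _ hφ e a ha ha0 hdisc c hcQ hcH hw
  refine h A φ e a hA hφ ha ha0 (fun hhyp => hδ ?_) c hw hcQ hcH
  exact (existsUnique_hasWeilDiscriminantNondeg hn hA hd hφ e ha ha0).unique hdisc
    (hasWeilDiscriminantNondeg_neg_one_pow_of_isHyperbolicWeilType hn hA hd hφ e ha ha0 hhyp)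

/-- **Every NON-split cell `(n, d, δ)`, `δ ≠ [(-1)ⁿ]` ⟹ the pointed non-split slice** (`n, d ≥ 1`). The
symmetrised hyperplane class of `(A, φ, e, a)` has SOME non-degenerate discriminant class `δ`
(`existsUnique_hasWeilDiscriminantNondeg`, van Geemen 5.2 (1)–(2)); if a NON-ZERO rational Hodge Weil class is
to be shown algebraic then `(A, φ)` is of Weil type and `δ = [(-1)ⁿ]` would make the class hyperbolic by
LANDHERR (`isHyperbolicWeilType_of_hasWeilDiscriminantNondeg_split`, a theorem of the tree via Meyer); so
`δ ≠ [(-1)ⁿ]` and the cell applies (the zero class is algebraic). [cite: vanGeemen1994HodgeAV, Lemma 5.2 (1)–(3), 5.4 and (5.4.1)]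
[cite: Landherr1936HermitianForms] -/
theorem weilAlgebraicNonsplitHyperplaneAt_of_nonsplit_components {n d : ℕ} (hn : 0 < n) (hd : 0 < d)
    (h : ∀ δ : weilNormResidueGroup d, δ ≠ splitDiscriminantClass n d → WeilClassesComponent n d δ) :
    WeilAlgebraicNonsplitHyperplaneAt n d := by
  intro A φ e a hA hφ ha ha0 hnon c hw hcQ hcH
  by_cases hc0 : c = 0
  · rw [hc0]
    exact Submodule.zero_mem _
  obtain ⟨δ, hdisc⟩ := (existsUnique_hasWeilDiscriminantNondeg hn hA hd hφ e ha ha0).exists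
  have hne : δ ≠ splitDiscriminantClass n d := by
    rintro rfl
    exact hnon (isHyperbolicWeilType_of_hasWeilDiscriminantNondeg_split hn hA hd hφ e ha ha0
      ⟨c, hw, hcQ, hcH, hc0⟩ hdisc)
  exact h δ hne A φ hA (isSmoothProjective_of_dim_eq' hA) hφ e a ha ha0 hdisc c hcQ hcH hw

/-- **§3 as an `↔`: the pointed non-split slice at `(n, d)` IS the conjunction of the non-split cells
`(n, d, δ)`, `δ ≠ [(-1)ⁿ]`** (`n, d ≥ 1`), fact-free. The δ-free name of Markman's "non-split components".
[cite: vanGeemen1994HodgeAV, Lemma 5.2 (1)–(3), 5.4 and (5.4.1)] [cite: Landherr1936HermitianForms]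
[cite: Markman2025SurveySecant, §11.5 Step 1] -/
theorem weilAlgebraicNonsplitHyperplaneAt_iff_nonsplit_components {n d : ℕ} (hn : 0 < n) (hd : 0 < d) :
    WeilAlgebraicNonsplitHyperplaneAt n d ↔
      ∀ δ : weilNormResidueGroup d, δ ≠ splitDiscriminantClass n d → WeilClassesComponent n d δ :=
  ⟨fun h _ hδ => weilClassesComponent_of_at hn hd h hδ,
    weilAlgebraicNonsplitHyperplaneAt_of_nonsplit_components hn hd⟩

/-! ### §4 Square-class transport of the pointed non-split slice — free of `HyperplanePullbackAlongIsogeny` -/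

/-- **DOWNWARD, free: the pointed non-split slice at `(n, m²d)` implies the one at `(n, d)`** (same variety and
polarization, `φ ↦ mφ`: the symmetrised class for `(mφ, m²d)` is `m²` times the one for `(φ, d)`, and
hyperbolicity is invariant under non-zero scalars and under `ψ ↦ mψ`). [cite: MoonenZarhin1998WeilClasses, §1]
[cite: vanGeemen1994HodgeAV, 5.2] -/
theorem weilAlgebraicNonsplitHyperplaneAt_of_sq_mul {n m d : ℕ} (hm : m ≠ 0)
    (hW : WeilAlgebraicNonsplitHyperplaneAt n (m ^ 2 * d)) : WeilAlgebraicNonsplitHyperplaneAt n d := by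
  rcases Nat.eq_zero_or_pos d with rfl | hd
  · simpa using hW
  intro A φ e a hA hφ ha ha0 hnon c hcW hrat hhodge
  have hφ' : ((m : ℤ) • φ) ≫ ((m : ℤ) • φ) = -((m ^ 2 * d) • 𝟙 A) := by
    rw [Preadditive.zsmul_comp, Preadditive.comp_zsmul, hφ, natCast_zsmul, natCast_zsmul, smul_neg,
      smul_neg, smul_smul, smul_smul, show m * m * d = m ^ 2 * d by ring]
  have hnon' : ¬ IsHyperbolicWeilType A ((m : ℤ) • φ) n
      (((m ^ 2 * d : ℕ) : ℂ) • complexBetti.map e.ι 2 a +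
        complexBetti.map ((m : ℤ) • φ).hom.hom.hom 2 (complexBetti.map e.ι 2 a)) := by
    rw [symmetrised_natCast_zsmul, isHyperbolicWeilType_smul_iff (pow_ne_zero 2 (Nat.cast_ne_zero.mpr hm)),
      isHyperbolicWeilType_natCast_zsmul_iff hm]
    exact hnon
  exact hW A ((m : ℤ) • φ) e a hA hφ' ha ha0 hnon' c (by rwa [weilClassesOf_zsmul_sq_mul hm hd.ne' hφ])
    hrat hhodge

/-- **UPWARD, FREE of `HyperplanePullbackAlongIsogeny`: the pointed non-split slice at `(n, d)` implies the one
at `(n, m²d)`** (`m ≥ 1`). Given `(A, φ', e, a)` with `φ'² = -m²d` and `d·m²·e^*a + φ'^*e^*a` NOT hyperbolic,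
gen 137's `exists_symmetrisedDescent` gives `B = A/(A[m] ∩ ker φ') ⊂ A × A` with `ψ² = -d`, `K`-equivariant
isogenies `p : A → B`, `f : B → A`, `p ∘ f = f ∘ p = [m]`, and an embedding `e'` of `B` whose symmetrised class
is a non-zero rational multiple of `d·f^*e^*a + ψ^*f^*e^*a = m⁻² · f^*(m²d·e^*a + φ'^*e^*a)`; hyperbolicity is
invariant along the `K`-isogeny `f` and under non-zero scalars, so `(B, ψ, e', a')` is NOT hyperbolic, the slice
at `(n, d)` applies on `B`, and `weilAlgebraicFor_of_descent` (`p^*f^* = m²ⁿ`) returns to `A`. Mumford §19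
Thm. 3 (a sublattice containing `mΛ` is an isogenous abelian variety through which `[m]` factors); no first
Chern class is used. [cite: MumfordAV1970, §19 Thm. 3 and p. 173] [cite: vanGeemen1994HodgeAV, Lemma 5.2 (3)]
[cite: MoonenZarhin1998WeilClasses, §1] -/
theorem weilAlgebraicNonsplitHyperplaneAt_sq_mul {n m d : ℕ} (hm : m ≠ 0)
    (hW : WeilAlgebraicNonsplitHyperplaneAt n d) : WeilAlgebraicNonsplitHyperplaneAt n (m ^ 2 * d) := by
  rcases Nat.eq_zero_or_pos d with rfl | hd
  · simpa using hW
  intro A φ' e a hA hφ' ha ha0 hnon c' hc'W hrat hhodge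
  obtain ⟨B, p, f, ψ, hp, hfi, hf, -, hψ, hfφ, -, e', a', c, ha', ha'0, hc, he'⟩ :=
    exists_symmetrisedDescent hm hd hφ' e a ha ha0
  have hB : B.dim = 2 * n := (AbelianVariety.dim_eq_of_isIsogenous_holds ⟨p, hp⟩).symm.trans hA
  have h₂ : ¬ IsHyperbolicWeilType B ψ n ((d : ℂ) • complexBetti.map e'.ι 2 a' +
      complexBetti.map ψ.hom.hom.hom 2 (complexBetti.map e'.ι 2 a')) := by
    intro hhyp
    apply hnon
    rw [he', isHyperbolicWeilType_smul_iff (by exact_mod_cast hc)] at hhyp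
    rw [isHyperbolicWeilType_iff_of_isIsogeny hfi hfφ, map_symmetrised_of_comm f hfφ,
      symmetrised_natCast_zsmul, isHyperbolicWeilType_smul_iff (pow_ne_zero 2 (Nat.cast_ne_zero.mpr hm)),
      isHyperbolicWeilType_natCast_zsmul_iff hm]
    exact hhyp
  exact weilAlgebraicFor_of_descent hm hd.ne' hA hp hf hψ hfφ (hW B ψ e' a' hB hψ ha' ha'0 h₂)
    c' hc'W hrat hhodge

/-- **The pointed non-split slice at `(n, m²d)` IS the one at `(n, d)`** (`m ≥ 1`), both ways free: the pointed
non-split `d`-slices are indexed by the Weil FIELD `K = ℚ(√-d)`. [cite: MoonenZarhin1998WeilClasses, §1] -/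
theorem weilAlgebraicNonsplitHyperplaneAt_sq_class_iff {n m d : ℕ} (hm : m ≠ 0) :
    WeilAlgebraicNonsplitHyperplaneAt n (m ^ 2 * d) ↔ WeilAlgebraicNonsplitHyperplaneAt n d :=
  ⟨weilAlgebraicNonsplitHyperplaneAt_of_sq_mul hm, weilAlgebraicNonsplitHyperplaneAt_sq_mul hm⟩

/-- **Squarefree `d` suffice on the pointed non-split slices — unconditionally** (`d = b²a`, `a` squarefree:
`Nat.sq_mul_squarefree_of_pos`). [cite: MoonenZarhin1998WeilClasses, §1] -/
theorem forall_weilAlgebraicNonsplitHyperplaneAt_iff_squarefree (n : ℕ) :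
    (∀ d : ℕ, 0 < d → WeilAlgebraicNonsplitHyperplaneAt n d) ↔
      ∀ d : ℕ, 0 < d → Squarefree d → WeilAlgebraicNonsplitHyperplaneAt n d := by
  refine ⟨fun h d hd _ => h d hd, fun h d hd => ?_⟩
  obtain ⟨a, b, ha, hb, rfl, hsq⟩ := Nat.sq_mul_squarefree_of_pos hd
  exact weilAlgebraicNonsplitHyperplaneAt_sq_mul hb.ne' (h a ha hsq)

/-- Consistency with gen 137's cell transport: through §3, the square class on the pointed slices is the
square class on the non-split cells (`weilClassesComponent_sq_class_iff'` and
`weilNormResidueGroupCongr_eq_split_iff`) — the same theorem reached δ-wise (`n, d ≥ 1`).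
[cite: vanGeemen1994HodgeAV, 4.14 and (5.4.1)] -/
theorem weilAlgebraicNonsplitHyperplaneAt_sq_mul_of_components {n m d : ℕ} (hm : m ≠ 0) (hn : 0 < n)
    (hd : 0 < d) (hW : WeilAlgebraicNonsplitHyperplaneAt n d) :
    WeilAlgebraicNonsplitHyperplaneAt n (m ^ 2 * d) :=
  weilAlgebraicNonsplitHyperplaneAt_of_nonsplit_components hn (by positivity) fun _ hδ =>
    weilClassesComponent_sq_mul' hm hd
      (weilClassesComponent_of_at hn hd hW fun hs => hδ ((weilNormResidueGroupCongr_eq_split_iff hm).1 hs))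

/-! ### §5 R1′ from the pointed slices at squarefree `d` — no print obligation -/

/-- **The un-pointed non-split slices at EVERY `d ≥ 1` from the pointed ones at SQUAREFREE `d`** (`n ≥ 1`),
free of `HyperplanePullbackAlongIsogeny`. [cite: MoonenZarhin1998WeilClasses, §1] [cite: vanGeemen1994HodgeAV, Lemma 5.2] -/
theorem forall_weilAlgebraicNonsplitHyperplane_of_squarefree_at {n : ℕ} (hn : 0 < n)
    (h : ∀ d : ℕ, 0 < d → Squarefree d → WeilAlgebraicNonsplitHyperplaneAt n d) :
    ∀ d : ℕ, 0 < d → WeilAlgebraicNonsplitHyperplane n d := fun d hd =>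
  weilAlgebraicNonsplitHyperplane_of_at hn hd ((forall_weilAlgebraicNonsplitHyperplaneAt_iff_squarefree n).2 h d hd)

/-- **R1′ from the pointed non-split sixfold slices, all `d`.** Only this direction: a fixed `(A, φ)` carries
polarizations of several discriminants. [cite: Markman2025SurveySecant, §1.1 and §11.5 Step 1]
[cite: vanGeemen1994HodgeAV, Lemma 5.2] -/
theorem nonsplitSixfolds_of_forall_at (h : ∀ d : ℕ, 0 < d → WeilAlgebraicNonsplitHyperplaneAt 3 d) :
    NonsplitSixfolds :=
  nonsplitSixfolds_iff_forall_nonsplitHyperplane.2 fun d hd =>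
    weilAlgebraicNonsplitHyperplane_of_at (by norm_num) hd (h d hd)

/-- **R1′ `NonsplitSixfolds` from the pointed non-split sixfold slices at SQUAREFREE `d` ALONE — no print
obligation, no named fact.** (Gen 5's `nonsplitSixfolds_iff_squarefree` needed `HyperplanePullbackAlongIsogeny`
for this direction in the un-pointed formulation.) OPEN on both sides; no case of HC is claimed.
[cite: Markman2025SurveySecant, §11.5 Step 1] [cite: MumfordAV1970, §19 Thm. 3] [cite: MoonenZarhin1998WeilClasses, §1] -/
theorem nonsplitSixfolds_of_squarefree_at
    (h : ∀ d : ℕ, 0 < d → Squarefree d → WeilAlgebraicNonsplitHyperplaneAt 3 d) : NonsplitSixfolds :=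
  nonsplitSixfolds_of_forall_at ((forall_weilAlgebraicNonsplitHyperplaneAt_iff_squarefree 3).2 h)

/-- **The same δ-wise: R1′ from the NON-split sixfold cells `(3, d, δ)`, `δ ≠ [-1]`, at SQUAREFREE `d` alone**
(gen 137's `forall_nonsplit_components_iff_squarefree'` composed with typer's binder-free
`nonsplitSixfolds_of_nonsplit_components'`). [cite: vanGeemen1994HodgeAV, Lemma 5.2 and (5.4.1)]
[cite: Markman2025SurveySecant, §11.5 Step 1] -/
theorem nonsplitSixfolds_of_squarefree_nonsplit_components
    (h : ∀ d : ℕ, 0 < d → Squarefree d → ∀ δ : weilNormResidueGroup d, δ ≠ splitDiscriminantClass 3 d →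
      WeilClassesComponent 3 d δ) : NonsplitSixfolds :=
  nonsplitSixfolds_of_nonsplit_components' ((forall_nonsplit_components_iff_squarefree' 3).2 h)

/-- **W₆ by the Weil field, δ-free**: R1 `WeilSixfolds` (all rational Hodge Weil classes on all abelian
sixfolds of Weil type) IS the conjunction, over SQUAREFREE `d` only, of the pointed non-split slice and the
split slice at `(3, d)` — unconditionally. [cite: Markman2025SurveySecant, §1.1 and §11.5]
[cite: MoonenZarhin1998WeilClasses, §1] [cite: vanGeemen1994HodgeAV, Lemma 5.2 (1)–(3)] -/
theorem weilSixfolds_iff_squarefree_at_and_split :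
    Theses.SevenfoldWeilCensus.WeilSixfolds ↔
      ∀ d : ℕ, 0 < d → Squarefree d →
        WeilAlgebraicNonsplitHyperplaneAt 3 d ∧ Stubs.WeilAlgebraicSplitHyperplane 3 d := by
  have key : Theses.SevenfoldWeilCensus.WeilSixfolds ↔ ∀ d : ℕ, 0 < d → WeilAlgebraicAll 3 d := by
    rw [weilSixfolds_iff_weilClassesOf]
    refine ⟨fun h d hd A φ hA hφ c hw hcQ hcH => h d hd A φ hA (isSmoothProjective_of_dim_eq' hA) hφ c hcQ hcH hw,
      fun h d hd A φ hA _ hφ c hcQ hcH hw => h d hd A φ hA hφ c hw hcQ hcH⟩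
  rw [key]
  refine ⟨fun h d hd _ => (weilAlgebraicAll_iff_at_and_split (by norm_num) hd).1 (h d hd), fun h => ?_⟩
  refine weilAlgebraicAll_of_squarefree fun d hd hsq => ?_
  exact (weilAlgebraicAll_iff_at_and_split (by norm_num) hd).2 (h d hd hsq)

/-! ### §6 Ledger: what the pointed re-typing does and does not erase -/

/-- **LEDGER.** ERASED (this file): `HyperplanePullbackAlongIsogeny` from the square-class transport of the
non-split side in the POINTED formulation (§4) and from "R1′ ⟸ squarefree non-split slices" (§5). NOT erased,
and not claimed: at a fixed `d`, un-pointed ⟹ pointed (`WeilAlgebraicNonsplitHyperplane n d →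
WeilAlgebraicNonsplitHyperplaneAt n d`) — a pair `(A, φ)` carrying polarizations of both discriminant types is
excluded by the un-pointed hypothesis but not by the pointed one; closing that gap needs the split slice
(§2 `weilAlgebraicNonsplitHyperplaneAt_of_nonsplit_of_split`, i.e. Markman's split statement at `(n, d)`) —
and hence gen 5's `↔` `nonsplitSixfolds_iff_squarefree` in the un-pointed formulation keeps its binder. Recorded
as the implication that IS available: granted the split slices at squarefree `d` (for `n = 3`: Markman's F2, a
`def`, as a hypothesis), the un-pointed squarefree non-split slices give the pointed ones, hence R1′.
[cite: Markman2025SurveySecant, §11.5 Step 1 and §12] [cite: vanGeemen1994HodgeAV, (5.4.1)] -/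
theorem nonsplitSixfolds_of_squarefree_nonsplit_of_squarefree_split
    (hS : ∀ d : ℕ, 0 < d → Squarefree d → Stubs.WeilAlgebraicSplitHyperplane 3 d)
    (hN : ∀ d : ℕ, 0 < d → Squarefree d → WeilAlgebraicNonsplitHyperplane 3 d) : NonsplitSixfolds :=
  nonsplitSixfolds_of_squarefree_at fun d hd hsq =>
    weilAlgebraicNonsplitHyperplaneAt_of_nonsplit_of_split (hN d hd hsq) (hS d hd hsq)

end Summit.HodgeConjecture.HodgeConjecture.Ring2.AbelianAll

end
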